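import Summits.BirchSwinnertonDyer.BirchSwinnertonDyer.Theorems.ByReductionTypeAtTwoOrdKatoHalfAtTwoIsoColemanMuFreeValueOrdKernel
import Literature.NumberTheory.EllipticCurves.Kato2004.LocalIwasawaCohomologyPoitouTateProofs
import Summits.BirchSwinnertonDyer.BirchSwinnertonDyer.Theorems.ByReductionTypeAtTwoOrdKatoHalfAtTwoIsoGreenbergMuDefs
import Summits.BirchSwinnertonDyer.BirchSwinnertonDyer.Theorems.ByReductionTypeAtTwoOrdKatoHalfAtTwoIsoPosDiscNecessity
import Summits.BirchSwinnertonDyer.BirchSwinnertonDyer.Theorems.ByReductionTypeAtTwoOrdKatoHalfAtTwoIsoPosDiscNecessityTwist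
import HarnessLib

/-!
# Route ByReductionTypeAtTwo, crux `OrdKatoHalfAtTwoIso` (stmt-BirchSwinnertonDyer-19573), line `steinberg-fibre-at-two`,
# F1 slot (child stmt-BirchSwinnertonDyer-24097) at `p = 2`: the doors of G11⁺ = `GreenbergMuZeroTwoOrdPosDisc` (Greenberg's Conjecture
# 1.11 at `2` on the `0 < Δ` cell) — G11⁺ ⟹ V♭⁺|habitat (Poitou–Tate exactness, p729889), G11⁺ ⟹ (A)₂, G11⁺ ⟺ the `0 < Δ` conjunct
# modulo print, V♭⁺|habitat ∧ Q⁺ ⟹ the conjunct (habitat-restricted (ε) road) ⟹ G11⁺, and the PAIR child from F1μι⁻ + G11⁺ — BY NAME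

Seat `cruxlead-stmt-BirchSwinnertonDyer-19573-w3` g6 (prover WIDTH under the LEAD `cruxlead-19573` g10; `--supports` stmt-BirchSwinnertonDyer-24097).
THEOREMS ONLY (no definition, no named fact, no `sorry`, no instance). HONEST FRAMING (cell bsd-2adic): BSD is not proved by any of this;
G11⁺ (`…GreenbergMuDefs`), Q⁺, V♭⁺, F1μι⁻ and the conjunct are displayed OPEN statements; print enters BY NAME as `OrdPublishedInputsAtTwo`
(PUB: modularity, GZK, Kato 17.4 (1)(2) at `2`, Greenberg 4.1), Abbes–Ullmo, Cassels; the Literature facts p729889 (Poitou–Tate exactness,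
every `p`), p723619 (its projection) and p727215 (ordinary-kernel functional) are print-composite readings (+1 debt each, audit-2 sheets
hpairPT/hOKF PASS, PT@2-REAL owed for clause (E)).

WHY (LEAD g10, HOME INBOX 2026-08-29T16:08Z; crux-triage r1-1 GEN 45 F-45b). Skeleton v24 replaces {`stub_muFreeValue_posDisc_two` (memo, the
rank-free value text V♭⁺) + `stub_conjA_two_posDisc` (research, Q⁺)} by ONE published-conjecture stub G11⁺. This file certifies the merge
LOSSLESS in the kernel and supplies the doors by name:
* `moduleFinite_selmerDual_of_greenbergMuZero` — G11⁺ + PUB ⟹ `X(W/ℚ_∞)` finitely generated over `ℤ₂` for every datum on the cell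
  (cotorsion from Kato 17.4 (1) INSIDE the glue; `μ = 0 ⟺` f.g. over `ℤ₂`, Washington §13.2).
* `muFreeValue_posDisc_habitat_of_poitouTate_of_greenbergMuZero` — p729889 + G11⁺ + PUB ⟹ **V♭⁺ RESTRICTED TO THE HABITAT** (the registered
  text of `stub_muFreeValue_posDisc_two` with the two binders `¬ W.HasCM → W.analyticRank = 0 →` inserted after `IsNewformOf W f →`): the
  Literature companion's `Kato2004.exists_notMem_col_loc_of_poitouTate_of_moduleFinite` (clause (E): Kato (17.13.1) EXACT at `2` on the strict `Γ`-carriers).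
* `fineSelmerDual_moduleFinite_of_greenbergMuZero` / `conjA_two_cyc_of_greenbergMuZero` — G11⁺ + PUB ⟹ (A)₂ at `(W, 2)` for every normalised
  pair / for `κ_cyc` (`X ↠ X₀`; lead g7's `fineSelmerDual_moduleFinite_of_forall_mu_eq_zero`).
* `ordKatoHalfAtTwoIsoPosDisc_of_greenbergMuZero` (G11⁺ + Abbes–Ullmo + Kato 17.4 ⟹ the `0 < Δ` conjunct: the DIRECT road
  `O1.katoMuPartAtTwo_of_mu_eq_zero`) and `greenbergMuZeroTwoOrdPosDisc_of_posDisc` (NECESSITY I p702303: conjunct + PUB + Cassels + AU ⟹ G11⁺):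
  **on the cell G11⁺ IS the conjunct modulo print.**
* `ordKatoHalfAtTwoIsoPosDisc_of_tateDuality_of_ordKernel_of_muFreeValueHabitat_of_conjA` — the (ε) road p700774 with V♭⁺ RESTRICTED to the
  habitat (no new fact: per-curve package by p723623/p727025, w2 GEN 4's `μ`-door) — and `greenbergMuZero_of_…` its composite with NECESSITY I:
  **V♭⁺|habitat ∧ Q⁺ ⟹ G11⁺** modulo print. Together with the second bullet: the merge is LOSSLESS (`μ(X) = μ(coarse) + μ(fine)`).
* `ordKatoFineZetaAtTwoResidue_of_negDisc_of_greenbergMuZero` — child 24097 BY NAME from F1μι⁻ (memo, `Δ < 0`) + G11⁺ + Abbes–Ullmo + Kato 17.4.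

References: [GreenbergLNM1716] Conj. 1.11 (p. 64), §4 p. 122; [Kato2004Asterisque] Thm 17.4 (1)(2) (p. 273), §17.13 (17.13.1)–(17.13.2) (p. 279);
[AbbesUllmo1996] Thm. A; [CoatesSujatha2005] Conj. A; [MilneADT2006] I Thm. 4.10, I.7.3; [Washington1997] §13.2; tree p700774, p702303, p723619,
p723623, p727025, p727215, p727801, p729889, the Literature proofs companion `Kato2004/LocalIwasawaCohomologyPoitouTateProofs.lean` and `…GreenbergMuDefs` (p733065).
-/

set_option autoImplicit false
set_option linter.dupNamespace false

noncomputable section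

open scoped Classical MatrixGroups ModularForm NumberField
open CongruenceSubgroup WeierstrassCurve Field IsDedekindDomain NumberField
open Literature.NumberTheory.GaloisRepresentations
open Literature.NumberTheory.GaloisCohomology
open Literature.NumberTheory.EllipticCurves Literature.NumberTheory.EllipticCurves.ModularForms
  Literature.NumberTheory.EllipticCurves.GreenbergSelmer
open Literature.NumberTheory.EllipticCurves.Kato2004
  Literature.NumberTheory.EllipticCurves.Kato2004.EulerSystemValues
open Literature.NumberTheory.EllipticCurves.IwasawaDual
open Literature.NumberTheory.EllipticCurves.Rank1Residual
open Literature.NumberTheory.EllipticCurves.Greenberg1999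
open Summit.BirchSwinnertonDyer.Rank1Residual Summit.BirchSwinnertonDyer.Rank1Residual.X5
open Summit.BirchSwinnertonDyer.BirchSwinnertonDyer.Theses.ByReductionTypeAtTwo


namespace Summit.BirchSwinnertonDyer.BirchSwinnertonDyer.Theorems.SteinbergFibreAtTwo

/-! ## §1 G11⁺ ⟹ finite generation over `ℤ₂`, the habitat-restricted value text V♭⁺, and (A)₂ -/

/-- **G11⁺ + PUB ⟹ `X(W/ℚ_∞)` is finitely generated over `ℤ₂`** for every curve of the `0 < Δ` cell and every normalised cyclotomic datum:
`Sel` is cotorsion by Kato 17.4 (1) at `2` (PUB, instantiated at the conductor-level newform from modularity), and for a finitely generated torsion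
`Λ`-module `μ = 0 ⟺` finitely generated over `ℤ₂` (`muInvariant_eq_zero_iff`, Washington §13.2). CONDITIONAL; nothing closed.
[cite: GreenbergLNM1716, Conj. 1.11 (p. 64)] [cite: Kato2004Asterisque, Thm. 17.4 (1) (p. 273)] [cite: Washington1997, §13.2] -/
theorem moduleFinite_selmerDual_of_greenbergMuZero (hG : GreenbergMuZeroTwoOrdPosDisc) (hPub : OrdPublishedInputsAtTwo)
    (W : WeierstrassCurve ℚ) [W.IsElliptic] [W.IsGloballyMinimal] (hcm : ¬ W.HasCM) (hr : W.analyticRank = 0)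
    (hgo : GoodOrd W 2) (h2 : W.HasSurjectiveModNGaloisRep 2) (hΔ : 0 < W.Δ)
    {κ : ZpExtension ℚ 2} {γ : absoluteGaloisGroup ℚ} (hκ : κ.IsCyclotomic) (hγ : κ.IsTopGenerator γ)
    (hγ' : IsCyclotomicVariable 2 γ) (D : W.SelmerDualData κ γ) :
    Module.Finite ℤ_[2] (RestrictScalars ℤ_[2] (IwasawaAlgebra 2) D.X) := by
  obtain ⟨hmod, -, h17, -⟩ := hPub
  haveI : NeZero (W.conductorNorm ℤ) := ⟨(W.conductorNorm_pos_holds).ne'⟩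
  obtain ⟨Dm⟩ := hmod W
  haveI : Module.Finite (IwasawaAlgebra 2) D.X := D.module_finite_holds hγ
  have hDt : D.IsTorsion := (h17 W Dm.f κ γ hκ hγ hγ' ⟨hgo.1, hgo.2⟩ Dm.isNewformOf D).1
  exact (muInvariant_eq_zero_iff_holds 2 D.X hDt).mp (hG W hcm hr hgo h2 hΔ κ γ hκ hγ hγ' D)

/-- **G11⁺ ⟹ V♭⁺ RESTRICTED TO THE HABITAT** (the text of `stub_muFreeValue_posDisc_two` of skeleton v23 with `¬ W.HasCM → W.analyticRank = 0 →`
inserted after `IsNewformOf W f →`), from the Poitou–Tate exactness fact p729889 and PUB: for every curve of the `0 < Δ` cell, all carriers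
and every normalised ordinary-kernel functional `col`, some `y ∈ 𝐇¹_Γ(T₂W)` has `col (loc₂ y) ∉ (2)`.  The Literature companion's
`Kato2004.exists_notMem_col_loc_of_poitouTate_of_moduleFinite` at `p = 2` (clause (E): `Sel^⊥ = range(J′ → J) + loc 𝐇¹_Γ`, Kato (17.13.1) EXACT at `2`
on the strict `Γ`-carriers) applied to `X` finitely generated over `ℤ₂` (§1).  PRICING: the `μ`-free-value half of the line on `0 < Δ` is
NECESSARY for G11⁺.  CONDITIONAL; nothing closed. [cite: GreenbergLNM1716, Conj. 1.11 (p. 64), §4 p. 122]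
[cite: Kato2004Asterisque, Thm. 17.4 (1) (p. 273), §17.13 (17.13.1)–(17.13.2) (p. 279)] [cite: MilneADT2006, I Thm. 4.10] -/
theorem muFreeValue_posDisc_habitat_of_poitouTate_of_greenbergMuZero (hPT : exists_lambdaAdicLocalTatePairing_poitouTate_exact)
    (hG : GreenbergMuZeroTwoOrdPosDisc) (hPub : OrdPublishedInputsAtTwo) :
    ∀ (W : WeierstrassCurve ℚ) [W.IsElliptic] [W.IsGloballyMinimal]
      [ContinuousSMul ℤ_[2] (W.tateModule 2)] [Module.Free ℤ_[2] (W.tateModule 2)] [Module.Finite ℤ_[2] (W.tateModule 2)]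
      {N : ℕ} [NeZero N] (f : CuspForm (Gamma0 N) 2)
      (κ : ZpExtension ℚ 2) (γ : absoluteGaloisGroup ℚ) (hκ : κ.IsCyclotomic) (hγ : κ.IsTopGenerator γ),
      0 < W.Δ → IsOrdinaryAt W 2 → W.HasSurjectiveModNGaloisRep 2 → IsCyclotomicVariable 2 γ → IsNewformOf W f →
      ¬ W.HasCM → W.analyticRank = 0 →
      ∀ (v₂ : HeightOneSpectrum (𝓞 ℚ)) (_ : ((2 : ℕ) : 𝓞 ℚ) ∈ v₂.asIdeal)
        (γᵥ : absoluteGaloisGroup (v₂.adicCompletion ℚ))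
        (hsurj : Function.Surjective
          (κ.toContinuousMonoidHom.comp (resGalOfEmb (closureEmb (K := ℚ) (v₂.adicCompletion ℚ)))))
        (hγᵥ : κ.IsTopGenerator (resGalOfEmb (closureEmb (K := ℚ) (v₂.adicCompletion ℚ)) γᵥ))
        (I : IwasawaH1Data W 2 κ γ) (J : LocalIwasawaH1Data κ v₂ ((tateRep W 2).toLocal v₂) γᵥ)
        (J' : LocalIwasawaH1Data κ v₂ (tateLocalOrdinaryRep W 2 v₂) γᵥ)
        (col : J.H →ₗ[IwasawaAlgebra 2] IwasawaAlgebra 2),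
        (∀ x : J.H, col x = 0 ↔ x ∈ LinearMap.range (J'.ordinaryInclusion J)) →
        (∃ x : J.H, col x ∉ IwasawaAlgebra.augIdealP 2) →
        ∃ y : I.H, col (I.loc J hsurj hγ hγᵥ y) ∉ IwasawaAlgebra.augIdealP 2 := by
  intro W _ _ _ _ _ N _ f κ γ hκ hγ hΔ hord h2 hγ' _ hcm hr v₂ hv₂ γᵥ hsurj hγᵥ I J J' col hker hnorm
  obtain ⟨D⟩ := W.nonempty_selmerDualData_holds κ γ hγ
  exact exists_notMem_col_loc_of_poitouTate_of_moduleFinite hPT W κ γ hκ hγ hord v₂ hv₂ γᵥ hsurj hγᵥ I J J' D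
    (moduleFinite_selmerDual_of_greenbergMuZero hG hPub W hcm hr ⟨hord.1, hord.2⟩ h2 hΔ hκ hγ hγ' D)
    col (fun y => (hker _).mpr ⟨y, rfl⟩) hnorm

/-- **G11⁺ + PUB ⟹ statement (A) at `(W, 2)` for every normalised cyclotomic pair** on the `0 < Δ` cell (`X ↠ X₀`; lead g7's
`fineSelmerDual_moduleFinite_of_forall_mu_eq_zero`). CONDITIONAL; nothing closed. [cite: CoatesSujatha2005, Conj. A (shape)]
[cite: GreenbergLNM1716, Conj. 1.11 (p. 64)] [cite: Kato2004Asterisque, Thm. 17.4 (1) (p. 273)] -/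
theorem fineSelmerDual_moduleFinite_of_greenbergMuZero (hG : GreenbergMuZeroTwoOrdPosDisc) (hPub : OrdPublishedInputsAtTwo)
    (W : WeierstrassCurve ℚ) [W.IsElliptic] [W.IsGloballyMinimal] (hcm : ¬ W.HasCM) (hr : W.analyticRank = 0)
    (hgo : GoodOrd W 2) (h2 : W.HasSurjectiveModNGaloisRep 2) (hΔ : 0 < W.Δ)
    {κ : ZpExtension ℚ 2} {γ : absoluteGaloisGroup ℚ} (hκ : κ.IsCyclotomic) (hγ : κ.IsTopGenerator γ)
    (hγ' : IsCyclotomicVariable 2 γ) (Y : W.FineSelmerDualData κ γ) :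
    Module.Finite ℤ_[2] (RestrictScalars ℤ_[2] (IwasawaAlgebra 2) Y.X) := by
  obtain ⟨hmod, -, h17, -⟩ := hPub
  exact fineSelmerDual_moduleFinite_of_forall_mu_eq_zero W (fun f ↦ h17 W f) hmod ⟨hgo.1, hgo.2⟩ hκ hγ hγ'
    (fun D ↦ hG W hcm hr hgo h2 hΔ κ γ hκ hγ hγ' D) Y

/-- **G11⁺ + PUB ⟹ statement (A) at `(W, 2)` in the `∃ γ D` currency for the canonical `κ_cyc`** (the normalised generator with `χ₂(γ) = 5`
exists and is a cyclotomic variable with `ζ = 1`; pattern of NECESSITY II‴ `conjA_two_cyc_of_posDisc`).  The route's Q⁺ quantifies over EVERY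
cyclotomic `κ`; the passage `κ_cyc ↦ κ` (same kernel `Gal(ℚ̄/ℚ_∞)`, `ℤ₂`-structure independent of the key) is not typed here.
[cite: CoatesSujatha2005, Conj. A (shape)] [cite: Washington1997, §13.1] -/
theorem conjA_two_cyc_of_greenbergMuZero (hG : GreenbergMuZeroTwoOrdPosDisc) (hPub : OrdPublishedInputsAtTwo)
    (W : WeierstrassCurve ℚ) [W.IsElliptic] [W.IsGloballyMinimal] (hcm : ¬ W.HasCM) (hr : W.analyticRank = 0)
    (hgo : GoodOrd W 2) (h2 : W.HasSurjectiveModNGaloisRep 2) (hΔ : 0 < W.Δ) :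
    ∃ (γ : absoluteGaloisGroup ℚ) (D : W.FineSelmerDualData (CyclotomicZp.zpExtension 2) γ),
      Module.Finite ℤ_[2] (RestrictScalars ℤ_[2] (IwasawaAlgebra 2) D.X) := by
  obtain ⟨γ, hγ, hχ⟩ := CyclotomicZp.exists_isTopGenerator_zpExtension 2
  have hγ' : IsCyclotomicVariable 2 γ := ⟨1, IsOfFinOrder.one, by rw [mul_one]; exact hχ⟩
  obtain ⟨Y⟩ := W.nonempty_fineSelmerDualData (CyclotomicZp.zpExtension 2) hγ
  exact ⟨γ, Y, fineSelmerDual_moduleFinite_of_greenbergMuZero hG hPub W hcm hr hgo h2 hΔ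
    (CyclotomicZp.isCyclotomic_zpExtension 2) hγ hγ' Y⟩

/-! ## §2 G11⁺ ⟺ the `0 < Δ` conjunct modulo print; the PAIR child -/

/-- **G11⁺ + Abbes–Ullmo + Kato 17.4 (1)(2) at `2` ⟹ the `0 < Δ` conjunct `OrdKatoHalfAtTwoIsoPosDisc`** (`W′ := W`): the DIRECT road —
`μ(X) = 0` for every datum is Kato's `μ`-part `O1.KatoMuPartAtTwo W` (`O1.katoMuPartAtTwo_of_mu_eq_zero`), and Abbes–Ullmo makes the Néron ratio
integral (`hint_two_of_abbesUllmo_of_irr`).  CONDITIONAL; nothing closed.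
[cite: GreenbergLNM1716, Conj. 1.11 (p. 64)] [cite: Kato2004Asterisque, Thm. 17.4 (1)(2) (p. 273)] [cite: AbbesUllmo1996, Thm. A] -/
theorem ordKatoHalfAtTwoIsoPosDisc_of_greenbergMuZero (hG : GreenbergMuZeroTwoOrdPosDisc)
    (hAU : abbesUllmo_not_dvd_maninConstant_of_not_dvd_level)
    (h17 : ∀ (V : WeierstrassCurve ℚ) [V.IsElliptic] [V.IsGloballyMinimal] [NeZero (V.conductorNorm ℤ)]
      (f : CuspForm (Gamma0 (V.conductorNorm ℤ)) 2), kato_divisibility_allPrimes V 2 (f := f)) :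
    OrdKatoHalfAtTwoIsoPosDisc := by
  intro W _ _ hcm hr hgo h2 hΔ
  haveI : NeZero ((2 : ℕ) : ℚ) := ⟨by norm_num⟩
  exact ⟨W, ‹_›, ‹_›, isIsogenous_self W,
    O1.mainConjectureLowerDivisibilityAtTwoOrd_of_katoMuPartAtTwo W (h17 W)
      (fun f hf ϖ hϖ => hint_two_of_abbesUllmo_of_irr hAU W hgo
        (hasIrreducibleModPGaloisRep_of_hasSurjectiveModNGaloisRep W 2 h2) f hf ϖ hϖ)
      (O1.katoMuPartAtTwo_of_mu_eq_zero W (fun κ γ hκ hγ hγ' D => hG W hcm hr hgo h2 hΔ κ γ hκ hγ hγ' D))⟩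

/-- **Conversely the `0 < Δ` conjunct + PUB + Cassels + Abbes–Ullmo ⟹ G11⁺** (NECESSITY I `mu_eq_zero_of_posDisc`, lead g7 p702303, by name).
So on the cell G11⁺ and the conjunct are EQUIVALENT modulo print: registering G11⁺ is neither stronger nor weaker than the item.
[cite: Kato2004Asterisque, Thm. 17.4 (1)(2) (p. 273)] [cite: AbbesUllmo1996, Thm. A] [cite: MilneADT2006, Thm. I.7.3 (Cassels)] -/
theorem greenbergMuZeroTwoOrdPosDisc_of_posDisc (hPos : OrdKatoHalfAtTwoIsoPosDisc) (hPub : OrdPublishedInputsAtTwo)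
    (hCassels : bsdRHS_eq_of_isIsogenous) (hAU : abbesUllmo_not_dvd_maninConstant_of_not_dvd_level) :
    GreenbergMuZeroTwoOrdPosDisc :=
  fun W _ _ hcm hr hgo h2 hΔ _ _ hκ hγ hγ' D => mu_eq_zero_of_posDisc hPos hPub hCassels hAU W hcm hr hgo h2 hΔ hκ hγ hγ' D

/-- **The PAIR child `OrdKatoFineZetaAtTwoResidue` (stmt-BirchSwinnertonDyer-24097) BY NAME from F1μι⁻ (`Δ < 0`, memo) and G11⁺** (+ Abbes–Ullmo
+ Kato 17.4 (1)(2) at `2`). CONDITIONAL on the displayed OPEN statements; nothing closed. [cite: GreenbergLNM1716, Conj. 1.11 (p. 64)]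
[cite: Kato2004Asterisque, Thm. 17.4 (1)(2) (p. 273), §17.13 (pp. 279–280)] -/
theorem ordKatoFineZetaAtTwoResidue_of_negDisc_of_greenbergMuZero (hNeg : ZetaColemanMuIotaNegDiscAtTwo)
    (hG : GreenbergMuZeroTwoOrdPosDisc) (hAU : abbesUllmo_not_dvd_maninConstant_of_not_dvd_level)
    (h17 : ∀ (V : WeierstrassCurve ℚ) [V.IsElliptic] [V.IsGloballyMinimal] [NeZero (V.conductorNorm ℤ)]
      (f : CuspForm (Gamma0 (V.conductorNorm ℤ)) 2), kato_divisibility_allPrimes V 2 (f := f)) :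
    OrdKatoFineZetaAtTwoResidue :=
  ordKatoFineZetaAtTwoResidue_of_halves hNeg (ordKatoHalfAtTwoIsoPosDisc_of_greenbergMuZero hG hAU h17)

/-! ## §3 The (ε) road with the value text RESTRICTED TO THE HABITAT, and the converse of the merge -/

/-- **HABITAT-RESTRICTED (ε) DOOR.**  The `0 < Δ` conjunct `OrdKatoHalfAtTwoIsoPosDisc` BY NAME from: the Tate-duality fact (p723619), the
ordinary-kernel functional (p727215), the value text V♭⁺ RESTRICTED to the crux habitat (two extra binders `¬ W.HasCM → W.analyticRank = 0 →`
after `IsNewformOf W f →`; otherwise verbatim `stub_muFreeValue_posDisc_two` of skeleton v23), Q⁺, Abbes–Ullmo and Kato 17.4 (1)(2) at `2`.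
The registered rank-free V♭⁺ is STRONGER than what the composition consumes: the (ε) door p700774 evaluates P⁺ only at habitat curves, so the
per-curve package (lead g9's `colemanMuSpanFree_invol_datum_of_locPairing_erl`, p723623, after the rescaling of p727025) and w2 GEN 4's
`katoMuPartAtTwo_of_colemanPackageSemilinear_of_finite_fineSelmer_irr` suffice.  A zero-price «sharpen» for the LEAD (weaker stub, same
composition); CONDITIONAL; nothing closed. [cite: Kato2004Asterisque, Thm. 17.4 (1)(2) (p. 273), §17.13 (pp. 279–280)] [cite: AbbesUllmo1996, Thm. A]
[cite: CoatesSujatha2005, Conj. A (shape)] -/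
theorem ordKatoHalfAtTwoIsoPosDisc_of_tateDuality_of_ordKernel_of_muFreeValueHabitat_of_conjA
    (hPT : exists_lambdaAdicLocalTatePairing_selmer_orthogonal) (hOK : exists_ordinaryKernelFunctional)
    (hV0 : ∀ (W : WeierstrassCurve ℚ) [W.IsElliptic] [W.IsGloballyMinimal]
      [ContinuousSMul ℤ_[2] (W.tateModule 2)] [Module.Free ℤ_[2] (W.tateModule 2)] [Module.Finite ℤ_[2] (W.tateModule 2)]
      {N : ℕ} [NeZero N] (f : CuspForm (Gamma0 N) 2)
      (κ : ZpExtension ℚ 2) (γ : absoluteGaloisGroup ℚ) (hκ : κ.IsCyclotomic) (hγ : κ.IsTopGenerator γ),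
      0 < W.Δ → IsOrdinaryAt W 2 → W.HasSurjectiveModNGaloisRep 2 → IsCyclotomicVariable 2 γ → IsNewformOf W f →
      ¬ W.HasCM → W.analyticRank = 0 →
      ∀ (v₂ : HeightOneSpectrum (𝓞 ℚ)) (_ : ((2 : ℕ) : 𝓞 ℚ) ∈ v₂.asIdeal)
        (γᵥ : absoluteGaloisGroup (v₂.adicCompletion ℚ))
        (hsurj : Function.Surjective
          (κ.toContinuousMonoidHom.comp (resGalOfEmb (closureEmb (K := ℚ) (v₂.adicCompletion ℚ)))))
        (hγᵥ : κ.IsTopGenerator (resGalOfEmb (closureEmb (K := ℚ) (v₂.adicCompletion ℚ)) γᵥ))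
        (I : IwasawaH1Data W 2 κ γ) (J : LocalIwasawaH1Data κ v₂ ((tateRep W 2).toLocal v₂) γᵥ)
        (J' : LocalIwasawaH1Data κ v₂ (tateLocalOrdinaryRep W 2 v₂) γᵥ)
        (col : J.H →ₗ[IwasawaAlgebra 2] IwasawaAlgebra 2),
        (∀ x : J.H, col x = 0 ↔ x ∈ LinearMap.range (J'.ordinaryInclusion J)) →
        (∃ x : J.H, col x ∉ IwasawaAlgebra.augIdealP 2) →
        ∃ y : I.H, col (I.loc J hsurj hγ hγᵥ y) ∉ IwasawaAlgebra.augIdealP 2)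
    (hQ : FineSelmerConjATwoOrdPosDisc) (hAU : abbesUllmo_not_dvd_maninConstant_of_not_dvd_level)
    (h17 : ∀ (V : WeierstrassCurve ℚ) [V.IsElliptic] [V.IsGloballyMinimal] [NeZero (V.conductorNorm ℤ)]
      (f : CuspForm (Gamma0 (V.conductorNorm ℤ)) 2), kato_divisibility_allPrimes V 2 (f := f)) :
    OrdKatoHalfAtTwoIsoPosDisc := by
  intro W _ _ hcm hr hgo h2 hΔ
  haveI : NeZero ((2 : ℕ) : ℚ) := ⟨by norm_num⟩
  haveI : ContinuousSMul ℤ_[2] (W.tateModule 2) := TateModule.continuousSMul_padicInt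
  haveI : Module.Free ℤ_[2] (W.tateModule 2) := W.module_free_tateModule_holds 2
  haveI : Module.Finite ℤ_[2] (W.tateModule 2) := W.module_finite_tateModule_holds 2
  have hord : IsOrdinaryAt W 2 := ⟨hgo.1, hgo.2⟩
  have hμpart : O1.KatoMuPartAtTwo W := by
    refine katoMuPartAtTwo_of_colemanPackageSemilinear_of_finite_fineSelmer_irr W
      (hasIrreducibleModPGaloisRep_of_hasSurjectiveModNGaloisRep W 2 h2) (fun f κ γ hκ hγ hγ' hf D Y ↦ ?_)
      (finite_fineSelmerInfty_twoTorsion_of_conjA_two W (hQ W hcm hr hgo h2 hΔ))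
    -- the carriers at `2`
    obtain ⟨v₂, hv₂⟩ : ∃ v : HeightOneSpectrum (𝓞 ℚ), ((2 : ℕ) : 𝓞 ℚ) ∈ v.asIdeal :=
      ⟨(Rat.HeightOneSpectrum.primesEquiv (R := 𝓞 ℚ)).symm ⟨2, Nat.prime_two⟩,
        (natCast_mem_asIdeal_iff_eq_primesEquiv_symm _ Nat.prime_two).mpr rfl⟩
    obtain ⟨γᵥ, hγᵥ⟩ := hκ.exists_isTopGenerator_resGalOfEmb_adicCompletion v₂ hv₂
    have hsurj := surjective_comp_resGalOfEmb_of_isCyclotomic (κ := κ) (v := v₂) hκ hv₂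
    obtain ⟨J⟩ := nonempty_localIwasawaH1Data κ v₂ ((tateRep W 2).toLocal v₂) γᵥ
    obtain ⟨J'⟩ := nonempty_localIwasawaH1Data κ v₂ (tateLocalOrdinaryRep W 2 v₂) γᵥ
    obtain ⟨I⟩ := nonempty_iwasawaH1Data_holds W 2 κ γ hκ hγ
    -- the pairing, the normalised ordinary-kernel functional, ONE global class with a `μ`-free value (restricted V♭⁺)
    obtain ⟨toDualP, hK, hT, hC, hS, hiso, hrec⟩ := hPT 2 W κ γ hκ hγ hord v₂ hv₂ γᵥ hsurj hγᵥ I J J'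
    obtain ⟨col, hker, hnorm⟩ := hOK 2 W κ v₂ γᵥ hκ hv₂ hord hγᵥ J J'
    obtain ⟨y, hval⟩ := hV0 W f κ γ hκ hγ hΔ hord h2 hγ' hf hcm hr v₂ hv₂ γᵥ hsurj hγᵥ I J J' col hker hnorm
    -- rescaling by the integral lift of `L₂(f, α)` (INT2-AUTO; non-zero by Rohrlich), as in p727025
    obtain ⟨L', hL'⟩ := exists_iwasawaToPowerSeries_eq_padicLFunction_two_auto hord hf
    have hL'0 : L' ≠ 0 := by
      rintro rfl
      exact padicLFunction_unitRoot_ne_zero hord hf (by rw [← hL', map_zero])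
    obtain ⟨col', hker', u, M, hM, hcol'⟩ :=
      exists_rescaled_col_of_notMem_augIdealP (LinearMap.range (J'.ordinaryInclusion J)) col (fun x hx => (hker x).mp hx)
        (I.loc J hsurj hγ hγᵥ y) hval hL'0
    have hcolφ : ∀ x : J.H, col' x = 0 → ∀ s : W.selmerInfty κ, toDualP x s = 0 := by
      intro x hx s
      obtain ⟨y', rfl⟩ := hker' x hx
      exact hiso y' s
    obtain ⟨P, M', τ, π, h⟩ := colemanMuSpanFree_invol_datum_of_locPairing_erl hκ D Y v₂ hv₂ toDualP hK hT hC hS col' hcolφ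
      (I.loc J hsurj hγ hγᵥ y) (fun s => hrec y s) ⟨u, M, L', 1, hM, norm_one, by rw [map_one, one_mul, hL'], hcol'⟩
    exact ⟨(IwasawaAlgebra.involEquiv 2).toRingEquiv, P, M', τ, π, h⟩
  exact ⟨W, ‹_›, ‹_›, isIsogenous_self W,
    O1.mainConjectureLowerDivisibilityAtTwoOrd_of_katoMuPartAtTwo W (h17 W)
      (fun f hf ϖ hϖ => hint_two_of_abbesUllmo_of_irr hAU W hgo
        (hasIrreducibleModPGaloisRep_of_hasSurjectiveModNGaloisRep W 2 h2) f hf ϖ hϖ) hμpart⟩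


/-- **V♭⁺|habitat ∧ Q⁺ ⟹ G11⁺ modulo print** (the habitat-restricted (ε) road, then NECESSITY I): with §1's converse doors this is the kernel
certificate that the v24 merge {V♭⁺, Q⁺} ↦ G11⁺ is LOSSLESS (`μ(X) = μ(coarse) + μ(fine)`, crux-triage r1-1 GEN 45 F-45b). CONDITIONAL; nothing
closed. [cite: GreenbergLNM1716, Conj. 1.11 (p. 64)] [cite: Kato2004Asterisque, Thm. 17.4 (1)(2) (p. 273)] -/
theorem greenbergMuZero_of_tateDuality_of_ordKernel_of_muFreeValueHabitat_of_conjA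
    (hPT : exists_lambdaAdicLocalTatePairing_selmer_orthogonal) (hOK : exists_ordinaryKernelFunctional)
    (hV0 : ∀ (W : WeierstrassCurve ℚ) [W.IsElliptic] [W.IsGloballyMinimal]
      [ContinuousSMul ℤ_[2] (W.tateModule 2)] [Module.Free ℤ_[2] (W.tateModule 2)] [Module.Finite ℤ_[2] (W.tateModule 2)]
      {N : ℕ} [NeZero N] (f : CuspForm (Gamma0 N) 2)
      (κ : ZpExtension ℚ 2) (γ : absoluteGaloisGroup ℚ) (hκ : κ.IsCyclotomic) (hγ : κ.IsTopGenerator γ),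
      0 < W.Δ → IsOrdinaryAt W 2 → W.HasSurjectiveModNGaloisRep 2 → IsCyclotomicVariable 2 γ → IsNewformOf W f →
      ¬ W.HasCM → W.analyticRank = 0 →
      ∀ (v₂ : HeightOneSpectrum (𝓞 ℚ)) (_ : ((2 : ℕ) : 𝓞 ℚ) ∈ v₂.asIdeal)
        (γᵥ : absoluteGaloisGroup (v₂.adicCompletion ℚ))
        (hsurj : Function.Surjective
          (κ.toContinuousMonoidHom.comp (resGalOfEmb (closureEmb (K := ℚ) (v₂.adicCompletion ℚ)))))
        (hγᵥ : κ.IsTopGenerator (resGalOfEmb (closureEmb (K := ℚ) (v₂.adicCompletion ℚ)) γᵥ))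
        (I : IwasawaH1Data W 2 κ γ) (J : LocalIwasawaH1Data κ v₂ ((tateRep W 2).toLocal v₂) γᵥ)
        (J' : LocalIwasawaH1Data κ v₂ (tateLocalOrdinaryRep W 2 v₂) γᵥ)
        (col : J.H →ₗ[IwasawaAlgebra 2] IwasawaAlgebra 2),
        (∀ x : J.H, col x = 0 ↔ x ∈ LinearMap.range (J'.ordinaryInclusion J)) →
        (∃ x : J.H, col x ∉ IwasawaAlgebra.augIdealP 2) →
        ∃ y : I.H, col (I.loc J hsurj hγ hγᵥ y) ∉ IwasawaAlgebra.augIdealP 2)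
    (hQ : FineSelmerConjATwoOrdPosDisc) (hPub : OrdPublishedInputsAtTwo) (hCassels : bsdRHS_eq_of_isIsogenous)
    (hAU : abbesUllmo_not_dvd_maninConstant_of_not_dvd_level) : GreenbergMuZeroTwoOrdPosDisc := by
  have h17 : ∀ (V : WeierstrassCurve ℚ) [V.IsElliptic] [V.IsGloballyMinimal] [NeZero (V.conductorNorm ℤ)]
      (f : CuspForm (Gamma0 (V.conductorNorm ℤ)) 2), kato_divisibility_allPrimes V 2 (f := f) := hPub.2.2.1
  exact greenbergMuZeroTwoOrdPosDisc_of_posDisc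
    (ordKatoHalfAtTwoIsoPosDisc_of_tateDuality_of_ordKernel_of_muFreeValueHabitat_of_conjA hPT hOK hV0 hQ hAU h17) hPub hCassels hAU

/-! ## §4 (appended) G11⁺ ⟹ Q⁺ literally -/

/-- **G11⁺ + PUB ⟹ Q⁺ = `FineSelmerConjATwoOrdPosDisc` LITERALLY** (Coates–Sujatha's (A) at `(W, 2)` for EVERY cyclotomic `ℤ₂`-extension,
`∃ γ D` spelling): (A)₂ at the canonical `κ_cyc` (above) in the «`Sel₀[2]` finite» currency (lead g7's
`finite_fineSelmerInfty_twoTorsion_of_forall_mu_eq_zero`), transported to every cyclotomic `κ` (the fine Selmer group depends on `ker κ`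
only: `finite_twoTorsion_fineSelmerInfty_of_isCyclotomic`, p702834) and converted back (`exists_fineSelmerDualData_moduleFinite_iff_finite_pTorsion`).
With `muFreeValue_posDisc_habitat_of_poitouTate_of_greenbergMuZero` this completes «G11⁺ ⟹ V♭⁺|habitat ∧ Q⁺». CONDITIONAL; nothing closed.
[cite: CoatesSujatha2005, Conj. A and Thm. 3.4] [cite: GreenbergLNM1716, Conj. 1.11 (p. 64)] [cite: Washington1997, §13.1] -/
theorem fineSelmerConjATwoOrdPosDisc_of_greenbergMuZero (hG : GreenbergMuZeroTwoOrdPosDisc) (hPub : OrdPublishedInputsAtTwo) :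
    FineSelmerConjATwoOrdPosDisc := by
  intro W _ _ hcm hr hgo h2 hΔ κ hκ
  have hPub' := hPub
  obtain ⟨hmod, -, h17, -⟩ := hPub'
  obtain ⟨γ, hγ, hχ⟩ := CyclotomicZp.exists_isTopGenerator_zpExtension 2
  have hγ' : IsCyclotomicVariable 2 γ := ⟨1, IsOfFinOrder.one, by rw [mul_one]; exact hχ⟩
  have hfin := finite_fineSelmerInfty_twoTorsion_of_forall_mu_eq_zero W (fun f ↦ h17 W f) hmod ⟨hgo.1, hgo.2⟩
    (CyclotomicZp.isCyclotomic_zpExtension 2) hγ hγ'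
    (fun D ↦ hG W hcm hr hgo h2 hΔ _ γ (CyclotomicZp.isCyclotomic_zpExtension 2) hγ hγ' D)
  have hfin' := finite_twoTorsion_fineSelmerInfty_of_isCyclotomic W (CyclotomicZp.isCyclotomic_zpExtension 2) hκ hfin
  obtain ⟨γ₀, hγ₀⟩ : ∃ γ₀ : absoluteGaloisGroup ℚ, κ.IsTopGenerator γ₀ := κ.surjective (Multiplicative.ofAdd 1)
  exact (IwasawaModuleFinitePadicInt.exists_fineSelmerDualData_moduleFinite_iff_finite_pTorsion W κ hγ₀).mpr hfin'

end Summit.BirchSwinnertonDyer.BirchSwinnertonDyer.Theorems.SteinbergFibreAtTwo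

end
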